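import Summits.PneNP.PneNP.Theorems.ExpanderLinearGeneratorsLinearGeneratorModPFregeHardMod2Xor
import Summits.PneNP.PneNP.Theorems.ExpanderLinearGeneratorsLinearGeneratorModPFregeHardCalibration
import HarnessLib

/-!
# `MOD₂` summation, concrete level, V: bookkeeping for the assembly (lengths, sizes, depths)

Support file for item `stmt-PneNP-11444` (`LinearGeneratorModPFregeHard`), calibration line "for
`p = 2` the rung fails".  Small syntactic facts used when the abstract summation
(`…Mod2Chain.lean`) is instantiated (`…Mod2Refute.lean`): the length of the hypothesis list, the
size and depth of the goal formula `G = ¬H₁ ∨ (⋯ (¬H_N ∨ ¬ofCNF φ))`, base-ness of the context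
members, and two measure facts (`|φ| ≤ |ofCNF φ|`, a line is no larger than the proof).

No definitions are introduced.

Sources: bookkeeping folklore over the definitions of `Frege.lean`, `FregeBounded.lean`,
`KEvaluations.lean`.
-/

set_option linter.dupNamespace false -- `Summit.PneNP.PneNP.…`: summit = sub-problem (D-0017)

namespace Summit.PneNP.PneNP.Theorems.ModTwo

open Literature.Computability.Complexity Literature.Computability.Complexity.PropForm
open Literature.Computability.MetaComplexity Literature.Computability.MetaComplexity.DepthFrege
open Literature.Computability.MetaComplexity.TextbookFrege (conjList)
open Literature.Computability.MetaComplexity.KEval (litForm clauseForm clauseForm_cons ofCNF_cons)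

/-! ### Lengths -/

/-- A `flatMap` with pieces of constant length. [folklore] -/
theorem length_flatMap_of_const {α β : Type*} (f : α → List β) (c : ℕ) :
    ∀ L : List α, (∀ a ∈ L, (f a).length = c) → (L.flatMap f).length = L.length * c
  | [], _ => by simp
  | a :: L, h => by
    rw [List.flatMap_cons, List.length_append, h a List.mem_cons_self,
      length_flatMap_of_const f c L (fun b hb => h b (List.mem_cons_of_mem _ hb)), List.length_cons]
    ring

/-- The number of clauses is at most the size of the CNF formula. [folklore] -/
theorem length_le_size_ofCNF : ∀ φ : CNF ℕ, φ.length ≤ (PropForm.ofCNF φ).size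
  | [] => by simp [PropForm.ofCNF, size]
  | C :: φ => by
    rw [ofCNF_cons, List.length_cons]
    have := length_le_size_ofCNF φ
    simp only [size]; omega

/-- A line is no larger than the whole proof; a proof has no more lines than symbols. [folklore] -/
theorem size_le_proofSize {π : List (PropForm ℕ)} {ψ : PropForm ℕ} (h : ψ ∈ π) :
    ψ.size ≤ proofSize π ∧ π.length ≤ proofSize π := by
  constructor
  · obtain ⟨L₁, L₂, rfl⟩ := List.append_of_mem h
    simp [proofSize, List.sum_append]
    omega
  · clear h
    induction π with
    | nil => simp [proofSize]
    | cons χ π ih =>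
      have := χ.size_pos
      simp only [proofSize, List.map_cons, List.sum_cons, List.length_cons] at ih ⊢
      omega

/-! ### The goal formula `G = ¬H₁ ∨ (⋯ (¬H_N ∨ X))` -/

/-- Size of the right-nested goal formula. [folklore] -/
theorem size_foldr_negDisj (X : PropForm ℕ) {b : ℕ} :
    ∀ HL : List (PropForm ℕ), (∀ H ∈ HL, H.size ≤ b) →
      (HL.foldr (fun H R => disj (neg H) R) X).size ≤ (b + 2) * HL.length + X.size ∧
      X.size ≤ (HL.foldr (fun H R => disj (neg H) R) X).size
  | [], _ => by simp
  | H :: HL, h => by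
    obtain ⟨ih1, ih2⟩ := size_foldr_negDisj X HL (fun H' hH' => h H' (List.mem_cons_of_mem _ hH'))
    have hH := h H List.mem_cons_self
    simp only [List.foldr_cons, size, List.length_cons]
    constructor
    · nlinarith [ih1, hH]
    · omega

/-- Depth of the right-nested goal formula: if every `¬H` and `X` have depth `≤ 7` then `G` has
depth `≤ 8` (one `∨`-block on top). [Krajíček 1995, §4.3] [folklore] -/
theorem altDepth_foldr_negDisj_le (X : PropForm ℕ) (hX : X.altDepth ≤ 7) :
    ∀ HL : List (PropForm ℕ), (∀ H ∈ HL, (neg H).altDepth ≤ 7) →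
      (HL.foldr (fun H R => disj (neg H) R) X).altDepth ≤ 8 ∧
      altDepthAux 3 (HL.foldr (fun H R => disj (neg H) R) X) ≤ 7
  | [], _ => by
    refine ⟨hX.trans (by norm_num), (DepthFrege.altDepthAux_le_altDepth 3 X).trans hX⟩
  | H :: HL, h => by
    obtain ⟨-, ih2⟩ := altDepth_foldr_negDisj_le X hX HL
      (fun H' hH' => h H' (List.mem_cons_of_mem _ hH'))
    have hH : altDepthAux 3 (neg H) ≤ 7 := (DepthFrege.altDepthAux_le_altDepth 3 _).trans (h H List.mem_cons_self)
    simp only [List.foldr_cons, altDepth, altDepthAux, show (0 : ℕ) ≠ 3 from by decide, if_false,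
      if_true]
    simp only [altDepthAux] at hH
    constructor <;> omega

/-! ### Base-ness of the context -/

/-- A negated clause of `φ` is a base formula once `D ≥ 3` and `M ≥ |ofCNF φ| + 1`. [folklore] -/
theorem base_neg_clauseForm {Q : SPrm} {φ : CNF ℕ} {C : Clause ℕ} (hC : C ∈ φ) (hD : 3 ≤ Q.D)
    (hM : (PropForm.ofCNF φ).size + 1 ≤ Q.M) : Base Q (neg (clauseForm C)) := by
  constructor
  · have := altDepthAux_clauseForm_le 1 C
    simp only [altDepth, altDepthAux, show (0 : ℕ) ≠ 1 from by decide, if_false]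
    omega
  · have hlt : (clauseForm C).size < (PropForm.ofCNF φ).size := by
      rw [ofCNF_eq_conjList]
      exact TextbookFrege.size_lt_size_conjList (List.mem_map_of_mem hC)
    simp only [size]; omega

end Summit.PneNP.PneNP.Theorems.ModTwo
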